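import Mathlib
import HarnessLib
import Summits.AtomisticToContinuum.Crystallization.Theorems.PricedLinkCensusSoftFourRingsCapFacetKinds
import Summits.AtomisticToContinuum.Crystallization.Theorems.PricedLinkCensusSoftFourRingsTypeAPrep

/-!
# Soft four-rings, endgame: preparations for the type-A cell lemma

Support file for `SoftFourRings` (route `PricedLinkCensus`, sub-problem `Crystallization`),
endgame step (E1) of the evidence file (§12.8): small set-theoretic helpers
(`eq_four_of_three_mem`, `eq_three_of_two_mem`, `tri_swap23`, `tri_rotl`, `side_eq_pair`,
`mem_bonds_of_nb_zero`) and, for a **type-A vertex** `v` (bonds `w 0, …, w 3`, bonded link pairs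
exactly `{w i, w j}` and `{w j, w k}`):

* `not_mem_bonds_gamma` — no bonded link pair contains the `γ`-index `l`;
* `ne_link_of_bond_gamma` — a point bonded to `w l` is not a bond of `v`;
* `facet_through_alpha` — a facet through the `α`-bond `{v, w j}` is one of the two bond
  triangles (no third facet through a hull edge).

**`Cap` variant** (seat c3 of stmt-AtomisticToContinuum-14234): identical to `PricedLinkCensusSoftFourRingsTypeAPrep`, except that the
global Tammes-13 hypothesis `(hT : musinTarasov2012_tammes_thirteen)` is replaced by the LOCAL covering
property of the twelve directions, `hT : ∀ p, ‖p‖ = 1 → ∃ x ∈ X, dist p x < 0.957` (no empty cap of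
angular radius `57.18°`), which is all the two roots (`FacetCap`, `Interior`) ever used; the hT-free
lemmas are not repeated (the original file is imported for them).
-/

namespace Summit.AtomisticToContinuum.Crystallization.Theorems.Cap

open Real RealInnerProductSpace Literature.Geometry.DiscreteGeometry

section Generic

end Generic

section Setting

open scoped Classical in
/-- **No third facet through the `α`-bond `{v, w j}`**: a facet containing `v` and `w j` is one
of the two bond triangles `{v, w i, w j}`, `{v, w j, w k}`. -/
theorem facet_through_alpha
    {X : Finset (EuclideanSpace ℝ (Fin 3))}
    {B : Finset (Finset (EuclideanSpace ℝ (Fin 3)))}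
    (hT : ∀ p : EuclideanSpace ℝ (Fin 3), ‖p‖ = 1 → ∃ x ∈ X, dist p x < 0.957)
    (hX1 : ∀ y ∈ X, ‖y‖ = 1)
    (hcard : X.card = 12)
    (hsepX : ∀ u ∈ X, ∀ u' ∈ X, u ≠ u' → ⟪u, u'⟫ ≤ 1 - 1 / (2 * (101 / 100 : ℝ) ^ 2))
    (hB : ∀ T ∈ B, ∃ u ∈ X, ∃ u' ∈ X, u ≠ u' ∧ 1 - (101 / 100 : ℝ) ^ 2 / 2 ≤ ⟪u, u'⟫ ∧ T = {u, u'})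
    (hBcard : B.card = 24)
    {v : EuclideanSpace ℝ (Fin 3)}
    (hv : v ∈ X)
    (w : Fin 4 → EuclideanSpace ℝ (Fin 3))
    (hwX : ∀ k, w k ∈ X)
    (hwinj : Function.Injective w)
    (hwv : ∀ k, w k ≠ v)
    (hvw : ∀ k, ({v, w k} : Finset (EuclideanSpace ℝ (Fin 3))) ∈ B)
    {i j k l : Fin 4}
    (hnd : [i, j, k, l].Nodup)
    (hBij : ({w i, w j} : Finset (EuclideanSpace ℝ (Fin 3))) ∈ B)
    (hBjk : ({w j, w k} : Finset (EuclideanSpace ℝ (Fin 3))) ∈ B) (c : EuclideanSpace ℝ (Fin 3)) (hcF : c ∈ facetNormals X)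
    (hvc : v ∈ tightSet X c) (hjc : w j ∈ tightSet X c) :
    tightSet X c = {v, w i, w j} ∨ tightSet X c = {v, w j, w k} := by
  obtain ⟨h0, hBH, -⟩ := hull_counts_of_twelve hT hX1 hcard hsepX hB hBcard
  have hnd' : i ≠ j ∧ j ≠ k ∧ i ≠ k := by
    simp only [List.nodup_cons, List.mem_cons, not_or, List.not_mem_nil,
      not_false_eq_true, and_true, List.nodup_nil] at hnd
    exact ⟨hnd.1.1, hnd.2.1.1, hnd.1.2.1⟩
  obtain ⟨c₁, hc₁F, hc₁T, -⟩ :=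
    bondTriangle_at_of_mem_bonds hX1 hsepX hB hv w hwX hwinj hwv hvw hnd'.1 hBij
  obtain ⟨c₂, hc₂F, hc₂T, -⟩ :=
    bondTriangle_at_of_mem_bonds hX1 hsepX hB hv w hwX hwinj hwv hvw hnd'.2.1 hBjk
  by_contra hne
  push Not at hne
  have hsub : ∀ c', c' ∈ facetNormals X → v ∈ tightSet X c' → w j ∈ tightSet X c' →
      ({v, w j} : Finset (EuclideanSpace ℝ (Fin 3))) ⊆ tightSet X c' := by
    intro c' _ h1 h2 y hy
    rw [Finset.mem_insert, Finset.mem_singleton] at hy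
    rcases hy with rfl | rfl <;> assumption
  have h1v : v ∈ tightSet X c₁ := by rw [hc₁T]; simp
  have h1j : w j ∈ tightSet X c₁ := by rw [hc₁T]; simp
  have h2v : v ∈ tightSet X c₂ := by rw [hc₂T]; simp
  have h2j : w j ∈ tightSet X c₂ := by rw [hc₂T]; simp
  have h12 : c₁ ≠ c₂ := by
    intro h
    have : w i ∈ tightSet X c₂ := by rw [← h, hc₁T]; simp
    rw [hc₂T] at this
    simp only [Finset.mem_insert, Finset.mem_singleton] at this
    rcases this with h' | h' | h'
    · exact hwv i h'
    · exact hnd'.1 (hwinj h')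
    · exact hnd'.2.2 (hwinj h')
  have h13 : c₁ ≠ c := fun h => hne.1 (by rw [← h, hc₁T])
  have h23 : c₂ ≠ c := fun h => hne.2 (by rw [← h, hc₂T])
  exact false_of_three_facetsOfEdge hX1 h0 (hBH (hvw j)) hc₁F hc₂F hcF (hsub c₁ hc₁F h1v h1j)
    (hsub c₂ hc₂F h2v h2j) (hsub c hcF hvc hjc) h12 h13 h23

end Setting

end Summit.AtomisticToContinuum.Crystallization.Theorems.Cap
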